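import Summits.AtomisticToContinuum.Crystallization.Theorems.ExcessDecayLiouvilleHcpLiouvilleSiteDichotomy
import Summits.AtomisticToContinuum.Crystallization.Theorems.ExcessDecayLiouvilleHcpLiouvilleRayIntegral

/-!
# `ExcessDecayLiouville.HcpLiouville` (stmt-AtomisticToContinuum-9332), line `Sketch`: box ⇒ ray-secant coercivity

Stub `stub_secant_of_box` of the line `two-level-caccioppoli` (crux `HcpLiouville`, lead skeleton
`Lines/Sketch.lean`): tangent ("box") coercivity `BoxCoercive (1/40) κ₁` of the Lennard-Jones second
variation at every configuration of the `1/40`-box around every admissible hcp-like datum implies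
ray-secant coercivity `SecantCoercive (1/20) κ₁` (same constant) from anchored equilibrium two-lattices.

Proof.  Fix the data of `SecantCoercive`: `(t, A)` admissible, an anchor `τ` (`‖τ‖ ≤ 1/20`) with
`t₁ = anchorDatum t τ` hcp-like, a field `v` with `‖v + τ𝟙₁‖ ≤ 1/40` on `S₁ = Sites₀ t₁ A`, a finitely
supported test field `φ ⊆ S₁`, and `θ ∈ [0,1]`.
* The interpolated datum `t₂ = anchorDatum t ((1−θ)τ)` is hcp-like (convexity of the norm ball,
  `inner₀_interp`).
* The map `f = id − θ·τ𝟙₁` (identity on sublattice `0`, translation by `−θτ` on sublattice `1`) is a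
  bijection `S₁ → S₂ = Sites₀ t₂ A`; it moves cross-sublattice distances by `≤ θ‖τ‖ ≤ 1/20` and keeps
  same-sublattice ones, so by the site dichotomy (`dist_sites_le_or_ge`: no site pair of an admissible
  datum at distance in `(51/50, 131/100)`) it preserves the nearest-neighbour graph `dist ≤ 11/10`.
* Transport `w₂ (f s) = θ (v s + τ𝟙₁ s)` (`‖w₂‖ ≤ θ/40`) and `φ₂ = φ ∘ f⁻¹`; then `f s + w₂ (f s) = s + θ v s`,
  so reindexing both double sums along `f` (`Equiv.tsum_eq`) gives `nnForm t₂ A φ₂ = nnForm t₁ A φ` and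
  `hessFormAt t₂ A w₂ φ₂ = T(θ) = Σ'Σ' [p ≠ q] Hess₀ ((p − q) + θ(v p − v q)) (φ p − φ q)`; the box
  inequality at `(t₂, A, w₂, φ₂)` reads `κ₁ · nnForm t₁ A φ ≤ T(θ)/2` (`box_transfer`).
* Integrate over `θ ∈ [0,1]`: `T` is continuous on `[0,1]` and `∫₀¹ T = secFormAt t₁ A v φ`
  (`ray_integral_eq_secFormAt`, dominated convergence), whence `κ₁ · nnForm ≤ secFormAt/2`.
All `[folklore]`; a `--supports` helper for item stmt-AtomisticToContinuum-9332, nothing here closes an item.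
-/

noncomputable section

namespace Summit.AtomisticToContinuum.Crystallization.Theorems.ExcessDecayLiouville

open scoped BigOperators Topology Classical InnerProductSpace
open Literature.MathematicalPhysics.StatisticalMechanics
open Summit.AtomisticToContinuum.Crystallization.Theses.ExcessDecayLiouville
open Summit.AtomisticToContinuum.Crystallization.Theorems.PhononStabilityNegative

local notation "E3" => EuclideanSpace ℝ (Fin 3)

section Transfer

variable {t : Fin 2 → E3} {A : E3 →L[ℝ] E3}

/-! ## The two sublattices and the shift field -/

/-- On sublattice `0` of an admissible hcp-like datum the shift field `τ𝟙₁` vanishes (the two cosets are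
disjoint: cross distances are `≥ 23/25`). [folklore] -/
private theorem shiftField_subl₀ (hA : Adm₀ A) (hI : Inner₀ t A) (τ : E3) {z : E3} (hz : z ∈ Λ₀) :
    shiftField t A τ (t 0 + A z) = 0 := by
  simp only [shiftField]
  rw [if_neg]
  rintro ⟨z', hz', h⟩
  have h1 := dist_sites_cross_ge hA hI hz hz'
  rw [← h, dist_self] at h1
  norm_num at h1

/-- On sublattice `1` the shift field `τ𝟙₁` is `τ`. [folklore] -/
private theorem shiftField_subl₁ (t : Fin 2 → E3) (A : E3 →L[ℝ] E3) (τ : E3) {z : E3} (hz : z ∈ Λ₀) :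
    shiftField t A τ (t 1 + A z) = τ := by
  simp only [shiftField]
  rw [if_pos ⟨z, hz, rfl⟩]

/-- On the sites the shift field `τ𝟙₁` takes only the values `0` and `τ`. [folklore] -/
private theorem shiftField_cases (hA : Adm₀ A) (hI : Inner₀ t A) (τ : E3) {s : E3}
    (hs : s ∈ Sites₀ t A) : shiftField t A τ s = 0 ∨ shiftField t A τ s = τ := by
  obtain ⟨m, z, hz, rfl⟩ := hs
  fin_cases m
  · exact Or.inl (shiftField_subl₀ hA hI τ hz)
  · exact Or.inr (shiftField_subl₁ t A τ hz)

/-- **Convexity of the window**: if `t` and `anchorDatum t τ` are hcp-like, so is the interpolated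
datum `anchorDatum t ((1 − θ)τ)` for `θ ∈ [0,1]`. [folklore] -/
private theorem inner₀_interp {τ : E3} {θ : ℝ} (hI : Inner₀ t A) (hIτ : Inner₀ (anchorDatum t τ) A)
    (hθ : θ ∈ Set.Icc (0 : ℝ) 1) : Inner₀ (anchorDatum t ((1 - θ) • τ)) A := by
  unfold Inner₀ at hI hIτ ⊢
  simp only [anchorDatum_one, anchorDatum_zero] at hIτ ⊢
  set m := A (barlowOffset 1 + layerNormal (Real.sqrt (2 / 3))) with hm
  have h : t 1 + (1 - θ) • τ - t 0 - m = (1 - θ) • (t 1 + τ - t 0 - m) + θ • (t 1 - t 0 - m) := by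
    module
  rw [h]
  have h0 : 0 ≤ 1 - θ := by linarith [hθ.2]
  have hθ0 : 0 ≤ θ := hθ.1
  calc ‖(1 - θ) • (t 1 + τ - t 0 - m) + θ • (t 1 - t 0 - m)‖
      ≤ ‖(1 - θ) • (t 1 + τ - t 0 - m)‖ + ‖θ • (t 1 - t 0 - m)‖ := norm_add_le _ _
    _ = (1 - θ) * ‖t 1 + τ - t 0 - m‖ + θ * ‖t 1 - t 0 - m‖ := by
        rw [norm_smul, norm_smul, Real.norm_eq_abs, Real.norm_eq_abs, abs_of_nonneg h0,
          abs_of_nonneg hθ.1]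
    _ ≤ (1 - θ) * (1 / 40) + θ * (1 / 40) := by gcongr
    _ = 1 / 40 := by ring

/-- A double `tsum` reindexed along an equivalence in both variables. [folklore] -/
private theorem tsum_tsum_equiv {α β : Type*} (e : α ≃ β) (G : β → β → ℝ) :
    ∑' p, ∑' q, G p q = ∑' p, ∑' q, G (e p) (e q) :=
  calc ∑' p, ∑' q, G p q = ∑' p, ∑' q, G (e p) q := (e.tsum_eq (fun p => ∑' q, G p q)).symm
    _ = ∑' p, ∑' q, G (e p) (e q) := tsum_congr fun p => (e.tsum_eq (G (e p))).symm

/-! ## Box ⇒ secant, pointwise in `θ` -/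

/-- **The box inequality transported along the anchored ray.**  Under the data of `SecantCoercive`
(anchor `τ`, `‖τ‖ ≤ 1/20`, anchored datum `t₁ = anchorDatum t τ` hcp-like, `‖v + τ𝟙₁‖ ≤ 1/40` on the
anchored sites, `φ` finitely supported) and `θ ∈ [0,1]`, box coercivity at radius `1/40`
applied at the interpolated datum `anchorDatum t ((1−θ)τ)`, to the transported displacement
`θ(v + τ𝟙₁) ∘ f⁻¹` and test field `φ ∘ f⁻¹` (`f = id − θ·τ𝟙₁`), gives
`κ₁ · nnForm t₁ A φ ≤ ½ Σ'Σ' [p ≠ q] Hess₀ ((p − q) + θ(v p − v q)) (φ p − φ q)`. [folklore] -/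
private theorem box_transfer {κ₁ : ℝ} (hBox : BoxCoercive (1 / 40) κ₁) {τ : E3} {θ : ℝ}
    (hA : Adm₀ A) (hI : Inner₀ t A) (hτ : ‖τ‖ ≤ 1 / 20) (hIτ : Inner₀ (anchorDatum t τ) A)
    {v : E3 → E3}
    (hv : ∀ s ∈ Sites₀ (anchorDatum t τ) A, ‖v s + shiftField (anchorDatum t τ) A τ s‖ ≤ 1 / 40)
    {φ : E3 → E3} (hφ : (Function.support φ).Finite) (hθ : θ ∈ Set.Icc (0 : ℝ) 1) :
    κ₁ * nnForm (anchorDatum t τ) A φ ≤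
      (∑' p : Sites₀ (anchorDatum t τ) A, ∑' q : Sites₀ (anchorDatum t τ) A,
        if (p : E3) ≠ q then Hess₀ ((p : E3) - q + θ • (v p - v q)) (φ p - φ q) else 0) / 2 := by
  -- the anchored datum `t₁`, the interpolated datum `t₂`, the shift field `σ = τ𝟙₁` of `t₁`
  set t₁ := anchorDatum t τ with ht₁
  set t₂ := anchorDatum t ((1 - θ) • τ) with ht₂
  set σ := shiftField t₁ A τ with hσ
  have hI₂ : Inner₀ t₂ A := inner₀_interp hI hIτ hθ
  have h10 : t₁ 0 = t 0 := by simp [ht₁]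
  have h11 : t₁ 1 = t 1 + τ := by simp [ht₁]
  have h20 : t₂ 0 = t 0 := by simp [ht₂]
  have h21 : t₂ 1 = t 1 + (1 - θ) • τ := by simp [ht₂]
  -- the forward map `f = id − θσ`: identity on sublattice `0`, translation by `−θτ` on sublattice `1`
  set f : E3 → E3 := fun s => s - θ • σ s with hf
  have hf0 : ∀ z ∈ Λ₀, f (t₁ 0 + A z) = t₂ 0 + A z := by
    intro z hz
    simp only [hf, hσ]
    rw [shiftField_subl₀ hA hIτ τ hz, smul_zero, sub_zero, h10, h20]
  have hf1 : ∀ z ∈ Λ₀, f (t₁ 1 + A z) = t₂ 1 + A z := by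
    intro z hz
    simp only [hf, hσ]
    rw [shiftField_subl₁ t₁ A τ hz, h11, h21, sub_smul, one_smul]
    abel
  have hmaps : Set.MapsTo f (Sites₀ t₁ A) (Sites₀ t₂ A) := by
    rintro s ⟨m, z, hz, rfl⟩
    fin_cases m
    · exact ⟨0, z, hz, hf0 z hz⟩
    · exact ⟨1, z, hz, hf1 z hz⟩
  have hinj : Set.InjOn f (Sites₀ t₁ A) := by
    rintro p ⟨m, z, hz, rfl⟩ q ⟨m', z', hz', rfl⟩ h
    fin_cases m <;> fin_cases m' <;> try simp only [Fin.zero_eta, Fin.mk_one] at h ⊢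
    · rw [hf0 z hz, hf0 z' hz'] at h
      rw [add_left_cancel h]
    · exfalso
      rw [hf0 z hz, hf1 z' hz'] at h
      have h1 := dist_sites_cross_ge hA hI₂ hz hz'
      rw [← h, dist_self] at h1
      norm_num at h1
    · exfalso
      rw [hf1 z hz, hf0 z' hz'] at h
      have h1 := dist_sites_cross_ge hA hI₂ hz' hz
      rw [h, dist_self] at h1
      norm_num at h1
    · rw [hf1 z hz, hf1 z' hz'] at h
      rw [add_left_cancel h]
  have hsurj : Set.SurjOn f (Sites₀ t₁ A) (Sites₀ t₂ A) := by
    rintro s ⟨m, z, hz, rfl⟩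
    fin_cases m
    · exact ⟨t₁ 0 + A z, ⟨0, z, hz, rfl⟩, hf0 z hz⟩
    · exact ⟨t₁ 1 + A z, ⟨1, z, hz, rfl⟩, hf1 z hz⟩
  have hbij : Set.BijOn f (Sites₀ t₁ A) (Sites₀ t₂ A) := ⟨hmaps, hinj, hsurj⟩
  set e : Sites₀ t₁ A ≃ Sites₀ t₂ A := hbij.equiv f with he
  have he_apply : ∀ p : Sites₀ t₁ A, (e p : E3) = f p := fun p => rfl
  -- `f` preserves the nearest-neighbour graph (site dichotomy on both data)
  have hnn : ∀ p ∈ Sites₀ t₁ A, ∀ q ∈ Sites₀ t₁ A,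
      (dist (f p) (f q) ≤ 11 / 10 ↔ dist p q ≤ 11 / 10) := by
    intro p hp q hq
    have hστ : ‖σ p - σ q‖ ≤ 1 / 20 := by
      show ‖shiftField t₁ A τ p - shiftField t₁ A τ q‖ ≤ 1 / 20
      rcases shiftField_cases hA hIτ τ hp with h | h <;>
        rcases shiftField_cases hA hIτ τ hq with h' | h' <;> rw [h, h'] <;>
          simp only [sub_zero, zero_sub, sub_self, norm_neg, norm_zero] <;>
            linarith [hτ, norm_nonneg τ]
    have hdiff : ‖θ • (σ p - σ q)‖ ≤ 1 / 20 := by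
      rw [norm_smul, Real.norm_eq_abs, abs_of_nonneg hθ.1]
      nlinarith [hθ.2, norm_nonneg (σ p - σ q)]
    have hfpq : f p - f q = (p - q) - θ • (σ p - σ q) := by
      simp only [hf, smul_sub]; abel
    have h1 : dist (f p) (f q) ≤ dist p q + 1 / 20 := by
      rw [dist_eq_norm, dist_eq_norm, hfpq]
      exact (norm_sub_le _ _).trans (by linarith)
    have h2 : dist p q ≤ dist (f p) (f q) + 1 / 20 := by
      rw [dist_eq_norm, dist_eq_norm, hfpq]
      have h3 := norm_sub_norm_le (p - q) (θ • (σ p - σ q))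
      linarith
    have hd1 := dist_sites_le_or_ge t₁ A hA hIτ p hp q hq
    have hd2 := dist_sites_le_or_ge t₂ A hA hI₂ (f p) (hmaps hp) (f q) (hmaps hq)
    constructor <;> intro h <;> rcases hd1 with h' | h' <;> rcases hd2 with h'' | h'' <;> linarith
  -- the transported displacement and test field on the sites of `t₂`
  set w₂ : E3 → E3 := fun s' =>
    if h : s' ∈ Sites₀ t₂ A then θ • (v (e.symm ⟨s', h⟩) + σ (e.symm ⟨s', h⟩)) else 0 with hw₂
  set φ₂ : E3 → E3 := fun s' => if h : s' ∈ Sites₀ t₂ A then φ (e.symm ⟨s', h⟩) else 0 with hφ₂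
  have hw₂e : ∀ p : Sites₀ t₁ A, w₂ (e p) = θ • (v p + σ p) := by
    intro p
    simp only [hw₂, dif_pos (e p).2, Subtype.coe_eta, Equiv.symm_apply_apply]
  have hφ₂e : ∀ p : Sites₀ t₁ A, φ₂ (e p) = φ p := by
    intro p
    simp only [hφ₂, dif_pos (e p).2, Subtype.coe_eta, Equiv.symm_apply_apply]
  have hw₂b : ∀ s' ∈ Sites₀ t₂ A, ‖w₂ s'‖ ≤ 1 / 40 := by
    intro s' hs'
    have hp := hv _ (e.symm ⟨s', hs'⟩).2
    simp only [hw₂, dif_pos hs']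
    rw [norm_smul, Real.norm_eq_abs, abs_of_nonneg hθ.1]
    nlinarith [hθ.2, norm_nonneg (v ↑(e.symm ⟨s', hs'⟩) + σ ↑(e.symm ⟨s', hs'⟩))]
  have hφ₂S : Function.support φ₂ ⊆ Sites₀ t₂ A := by
    intro s' hs'
    by_contra h
    exact hs' (by simp only [hφ₂, dif_neg h])
  have hφ₂f : (Function.support φ₂).Finite := by
    refine (hφ.image f).subset fun s' hs' => ?_
    have h2 : s' ∈ Sites₀ t₂ A := hφ₂S hs'
    refine ⟨(e.symm ⟨s', h2⟩ : E3), ?_, ?_⟩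
    · have h3 : φ₂ s' ≠ 0 := hs'
      simp only [hφ₂, dif_pos h2] at h3
      exact h3
    · rw [← he_apply, Equiv.apply_symm_apply]
  -- the box inequality at `(t₂, A, w₂, φ₂)`
  have hbox := hBox t₂ A hA hI₂ w₂ hw₂b φ₂ hφ₂f hφ₂S
  -- identification of both sides after reindexing along `e`
  have heq : ∀ p q : Sites₀ t₁ A, ((e p : E3) = e q) ↔ ((p : E3) = q) := by
    intro p q
    rw [Subtype.val_inj, e.apply_eq_iff_eq, Subtype.ext_iff]
  have hnnForm : nnForm t₂ A φ₂ = nnForm t₁ A φ := by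
    unfold nnForm
    rw [tsum_tsum_equiv e]
    refine tsum_congr fun p => tsum_congr fun q => ?_
    rw [hφ₂e, hφ₂e]
    simp only [he_apply]
    by_cases h : dist (p : E3) q ≤ 11 / 10
    · rw [if_pos ((hnn p p.2 q q.2).2 h), if_pos h]
    · rw [if_neg (fun h' => h ((hnn p p.2 q q.2).1 h')), if_neg h]
  have hhess : hessFormAt t₂ A w₂ φ₂ = ∑' p : Sites₀ t₁ A, ∑' q : Sites₀ t₁ A,
      if (p : E3) ≠ q then Hess₀ ((p : E3) - q + θ • (v p - v q)) (φ p - φ q) else 0 := by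
    unfold hessFormAt
    rw [tsum_tsum_equiv e]
    refine tsum_congr fun p => tsum_congr fun q => ?_
    by_cases hpq : (p : E3) = q
    · rw [if_neg (show ¬ ((e p : E3) ≠ e q) from fun h => h ((heq p q).2 hpq)),
        if_neg (show ¬ ((p : E3) ≠ q) from fun h => h hpq)]
    · rw [if_pos (show (e p : E3) ≠ e q from fun h => hpq ((heq p q).1 h)),
        if_pos (show (p : E3) ≠ q from hpq), hw₂e, hw₂e, hφ₂e, hφ₂e, he_apply, he_apply]
      congr 1
      simp only [hf, smul_add, smul_sub]
      abel
  rw [← hnnForm, ← hhess]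
  exact hbox

end Transfer

/-! ## The stub -/

/-- **Stub `stub_secant_of_box` (line `Sketch`, crux `HcpLiouville`)**: box (tangent) coercivity of the
Lennard-Jones second variation at radius `1/40` implies ray-secant coercivity at anchor radius `1/20`
with the same constant: transport the box inequality along the anchored ray pointwise in `θ`
(`box_transfer`) and integrate over `θ ∈ [0,1]` (`ray_integral_eq_secFormAt`). [folklore] -/
theorem stub_secant_of_box : ∀ κ₁ : ℝ, 0 < κ₁ → BoxCoercive (1 / 40) κ₁ → ∃ κ₁' : ℝ, 0 < κ₁' ∧ SecantCoercive (1 / 20) κ₁' := by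
  intro κ₁ hκ₁ hBox
  refine ⟨κ₁, hκ₁, ?_⟩
  intro t A τ hA hI hτ hIτ _hEq v hv φ hφ _hφS
  set T : ℝ → ℝ := fun θ => ∑' p : Sites₀ (anchorDatum t τ) A, ∑' q : Sites₀ (anchorDatum t τ) A,
      if (p : E3) ≠ q then Hess₀ ((p : E3) - q + θ • (v p - v q)) (φ p - φ q) else 0 with hT
  have hpt : ∀ θ ∈ Set.Icc (0 : ℝ) 1, κ₁ * nnForm (anchorDatum t τ) A φ ≤ T θ / 2 := fun θ hθ =>
    box_transfer hBox hA hI hτ hIτ hv hφ hθ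
  have hv' : ∀ s ∈ Sites₀ (anchorDatum t τ) A, ‖v s‖ ≤ 3 / 40 := by
    intro s hs
    have h1 := hv s hs
    have h2 : ‖shiftField (anchorDatum t τ) A τ s‖ ≤ 1 / 20 := by
      unfold shiftField
      split_ifs
      · exact hτ
      · rw [norm_zero]; norm_num
    have h3 := norm_sub_le (v s + shiftField (anchorDatum t τ) A τ s)
      (shiftField (anchorDatum t τ) A τ s)
    rw [add_sub_cancel_right] at h3
    linarith
  obtain ⟨hcont, hint⟩ := ray_integral_eq_secFormAt (anchorDatum t τ) A hA hIτ v φ hv' hφ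
  have hTI : IntervalIntegrable T MeasureTheory.volume 0 1 := by
    refine ContinuousOn.intervalIntegrable ?_
    rw [Set.uIcc_of_le zero_le_one]
    exact hcont
  have hmono := intervalIntegral.integral_mono_on (f := fun _ => κ₁ * nnForm (anchorDatum t τ) A φ)
    (g := fun θ => T θ / 2) zero_le_one intervalIntegrable_const (hTI.div_const 2) hpt
  rw [intervalIntegral.integral_const, sub_zero, one_smul, intervalIntegral.integral_div] at hmono
  have hint' : ∫ θ in (0 : ℝ)..1, T θ = secFormAt (anchorDatum t τ) A v φ := hint
  rw [hint'] at hmono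
  exact hmono

end Summit.AtomisticToContinuum.Crystallization.Theorems.ExcessDecayLiouville

end
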